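import Summits.NavierStokesRegularity.NavierStokesRegularity.Theorems.EfficiencyFloorNearSaturationNearMaximiserSeqCoreRellichOfHeat
import HarnessLib

/-!
# Route `EfficiencyFloor`, crux `NearSaturationNearMaximiser` (stmt-NavierStokesRegularity-25482) on the
# `ProductionEfficiencyDecay` ladder (stmt-22866): `L²`-CONTINUITY OF THE HEAT SEMIGROUP AT `0⁺` FROM THE MOLLIFICATION ESTIMATE

Def-free helper file, seventeenth of the group. Of the two heat-semigroup hypotheses of `localRellich_of_heat` (`…SeqCoreRellichOfHeat`),
(HC) — `∫‖e^{tΔ}G − G‖² → 0` as `t → 0⁺` for `G ∈ L²(ℝ³; ℝ³)` — follows from (HM) — the mollification estimate for `C¹` fields with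
`g, Dg ∈ L²` — by density of `C_c^∞` in `L²` (`MemLp.exists_hasCompactSupport_integral_rpow_sub_le` + `exists_smooth_compactSupport_L2_approx`)
and the `L²`-contraction of `e^{tΔ}` (`eLpNorm_heatExtension_le_holds`). Hence the by-name reduction of stmt-25482 needs only (HM) and (I).

* `heatExtension_sub_apply` — linearity `e^{tΔ}(G − h) = e^{tΔ}G − e^{tΔ}h` pointwise for `L²` data;
* `integral_norm_sq_heatExtension_le` — `∫‖e^{tΔ}f‖² ≤ ∫‖f‖²` (the contraction in integral form);
* `heat_L2_continuity_of_mollification` — (HC) ⟸ (HM);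
* `nearSaturationNearMaximiser_of_mollification_of_identification` — BY NAME: stmt-25482 ⟸ (HM) ∧ (I).

HONEST FRAMING: (HM) is standard but NOT yet proved in the tree; (I) is open; stmt-25482, `LerayFloorGap`, `ProductionEfficiencyDecay`
(stmt-22866) and Navier–Stokes regularity stay OPEN; no summit statement is proved. [folklore]
-/

-- the problem directory repeats the summit name (`NavierStokesRegularity/NavierStokesRegularity`)
set_option linter.dupNamespace false

noncomputable section

namespace Summit.NavierStokesRegularity.NavierStokesRegularity.Theorems

namespace NearSaturationNearMaximiser

namespace SeqCore

open Set MeasureTheory Filter Topology Function Real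
open scoped InnerProductSpace ENNReal NNReal
open Literature.Analysis.UnboundedOperators

/-! ## §1 Linearity and the `L²` contraction in integral form -/

/-- Linearity of the caloric extension on `L²` data: `e^{tΔ}(G − h)(x) = e^{tΔ}G(x) − e^{tΔ}h(x)`. [folklore] -/
theorem heatExtension_sub_apply {G h : EuclideanSpace ℝ (Fin 3) → EuclideanSpace ℝ (Fin 3)} (hG : MemLp G 2 volume)
    (hh : MemLp h 2 volume) {t : ℝ} (ht : 0 < t) (x : EuclideanSpace ℝ (Fin 3)) :
    heatExtension (fun y => G y - h y) t x = heatExtension G t x - heatExtension h t x := by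
  have hI : ∀ f : EuclideanSpace ℝ (Fin 3) → EuclideanSpace ℝ (Fin 3), MemLp f 2 volume →
      Integrable (fun y => heatKernel t (x - y) • f y) := by
    intro f hf
    have h := integrable_temperate_mul_heatKernel_smul (F := EuclideanSpace ℝ (Fin 3)) ht hf one_le_two
      (Function.HasTemperateGrowth.const (1 : ℝ)) x
    exact h.congr (ae_of_all _ fun y => by simp only [one_mul])
  rw [heatExtension_eq_integral_sub, heatExtension_eq_integral_sub, heatExtension_eq_integral_sub, ← integral_sub (hI G hG) (hI h hh)]
  refine integral_congr_ae (ae_of_all _ fun y => ?_)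
  simp only [smul_sub]

/-- **`L²` contraction in integral form**: `∫‖e^{tΔ}f‖² ≤ ∫‖f‖²` for `f ∈ L²`, `t > 0`. [folklore] -/
theorem integral_norm_sq_heatExtension_le {f : EuclideanSpace ℝ (Fin 3) → EuclideanSpace ℝ (Fin 3)} (hf : MemLp f 2 volume)
    {t : ℝ} (ht : 0 < t) :
    ∫ x, ‖heatExtension f t x‖ ^ 2 ≤ ∫ x, ‖f x‖ ^ 2 := by
  have hE : MemLp (heatExtension f t) 2 volume :=
    memLp_heatExtension_holds (E := EuclideanSpace ℝ (Fin 3)) (F := EuclideanSpace ℝ (Fin 3)) hf one_le_two ht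
  have h := eLpNorm_heatExtension_le_holds (E := EuclideanSpace ℝ (Fin 3)) (F := EuclideanSpace ℝ (Fin 3)) hf one_le_two ht
  rw [hE.eLpNorm_eq_integral_rpow_norm (by norm_num) (by norm_num), hf.eLpNorm_eq_integral_rpow_norm (by norm_num) (by norm_num)] at h
  simp only [ENNReal.toReal_ofNat, Real.rpow_two] at h
  have h0 : 0 ≤ ∫ x, ‖f x‖ ^ 2 := integral_nonneg fun x => by positivity
  have h1 : 0 ≤ ∫ x, ‖heatExtension f t x‖ ^ 2 := integral_nonneg fun x => by positivity
  rw [ENNReal.ofReal_le_ofReal_iff (Real.rpow_nonneg h0 _)] at h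
  have h2 := Real.rpow_le_rpow (Real.rpow_nonneg h1 _) h (by norm_num : (0 : ℝ) ≤ 2)
  rwa [← Real.rpow_mul h1, ← Real.rpow_mul h0, show ((2 : ℝ)⁻¹ * 2) = 1 by norm_num, Real.rpow_one, Real.rpow_one] at h2

/-! ## §2 (HC) from (HM) -/

/-- **`L²`-continuity of the heat semigroup at `0⁺` from the mollification estimate.** If `∫‖g − e^{tΔ}g‖² ≤ C_m · t · ∫‖Dg‖²` for all
`C¹` fields with `g, Dg ∈ L²`, then `∫‖e^{tΔ}G − G‖² → 0` as `t → 0⁺` for every `G ∈ L²(ℝ³; ℝ³)` (density of smooth compactly supported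
fields + contraction + the three-term bound). [folklore] -/
theorem heat_L2_continuity_of_mollification
    (HM : ∃ Cm : ℝ, ∀ g : EuclideanSpace ℝ (Fin 3) → EuclideanSpace ℝ (Fin 3), ContDiff ℝ 1 g →
      Integrable (fun x => ‖g x‖ ^ 2) → Integrable (fun x => ‖fderiv ℝ g x‖ ^ 2) → ∀ t : ℝ, 0 < t →
        Integrable (fun x => ‖g x - heatExtension g t x‖ ^ 2) ∧
          ∫ x, ‖g x - heatExtension g t x‖ ^ 2 ≤ Cm * t * ∫ x, ‖fderiv ℝ g x‖ ^ 2) :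
    ∀ G : EuclideanSpace ℝ (Fin 3) → EuclideanSpace ℝ (Fin 3), MemLp G 2 volume →
      Tendsto (fun t : ℝ => ∫ x, ‖heatExtension G t x - G x‖ ^ 2) (𝓝[>] 0) (𝓝 0) := by
  intro G hG
  obtain ⟨Cm, hM⟩ := HM
  rw [Metric.tendsto_nhdsWithin_nhds]
  intro ε hε
  -- a smooth compactly supported `h` with `∫‖G − h‖² ≤ ε/24`
  have hG' : MemLp G (ENNReal.ofReal 2) volume := by rw [ENNReal.ofReal_ofNat]; exact hG
  obtain ⟨ψ, hψc, hψε, hψcont, hψmem⟩ :=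
    hG'.exists_hasCompactSupport_integral_rpow_sub_le (p := 2) (by norm_num) (ε := ε / 96) (by positivity)
  have hψε' : ∫ x, ‖G x - ψ x‖ ^ 2 ≤ ε / 96 := by
    have e : ∫ x, ‖G x - ψ x‖ ^ (2 : ℝ) = ∫ x, ‖G x - ψ x‖ ^ (2 : ℕ) :=
      integral_congr_ae (ae_of_all _ fun x => Real.rpow_two _)
    rw [← e]
    exact hψε
  obtain ⟨h, R, -, hh, hhc, -, Iψh, hψh⟩ := exists_smooth_compactSupport_L2_approx hψcont hψc (δ := ε / 96) (by positivity)
  have hh1 : ContDiff ℝ 1 h := hh.of_le (by norm_cast)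
  have hhc2 : MemLp h 2 volume := hh.continuous.memLp_of_hasCompactSupport hhc
  have hψ2 : MemLp ψ 2 volume := by rwa [ENNReal.ofReal_ofNat] at hψmem
  have Ih2 : Integrable (fun x => ‖h x‖ ^ 2) := integrable_norm_sq_of_memLp_two hhc2
  have hDc : Continuous (fderiv ℝ h) := hh1.continuous_fderiv one_ne_zero
  have IDh : Integrable (fun x => ‖fderiv ℝ h x‖ ^ 2) :=
    (hDc.norm.pow 2).integrable_of_hasCompactSupport ((hhc.fderiv (𝕜 := ℝ)).mono fun x hx => by
      contrapose! hx
      simp only [mem_support, not_not] at hx ⊢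
      show ‖fderiv ℝ h x‖ ^ 2 = 0
      rw [hx, norm_zero]; ring)
  -- `∫‖G − h‖² ≤ ε/24`
  have IGψ : Integrable (fun x => ‖G x - ψ x‖ ^ 2) := integrable_norm_sq_of_memLp_two (hG.sub hψ2)
  have IGh : Integrable (fun x => ‖G x - h x‖ ^ 2) := integrable_norm_sq_of_memLp_two (hG.sub hhc2)
  have hGh : ∫ x, ‖G x - h x‖ ^ 2 ≤ ε / 24 := by
    have hpt : ∀ x, ‖G x - h x‖ ^ 2 ≤ 2 * ‖G x - ψ x‖ ^ 2 + 2 * ‖ψ x - h x‖ ^ 2 := fun x => by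
      have h1 : ‖G x - h x‖ ≤ ‖G x - ψ x‖ + ‖ψ x - h x‖ := by
        calc ‖G x - h x‖ = ‖(G x - ψ x) + (ψ x - h x)‖ := by congr 1; abel
          _ ≤ ‖G x - ψ x‖ + ‖ψ x - h x‖ := norm_add_le _ _
      nlinarith [sq_nonneg (‖G x - ψ x‖ - ‖ψ x - h x‖), norm_nonneg (G x - h x), norm_nonneg (G x - ψ x), norm_nonneg (ψ x - h x)]
    calc ∫ x, ‖G x - h x‖ ^ 2 ≤ ∫ x, (2 * ‖G x - ψ x‖ ^ 2 + 2 * ‖ψ x - h x‖ ^ 2) :=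
          integral_mono_of_nonneg (ae_of_all _ fun x => by positivity) ((IGψ.const_mul 2).add (Iψh.const_mul 2))
            (ae_of_all _ hpt)
      _ = 2 * (∫ x, ‖G x - ψ x‖ ^ 2) + 2 * ∫ x, ‖ψ x - h x‖ ^ 2 := by
          rw [integral_add (IGψ.const_mul 2) (Iψh.const_mul 2), integral_const_mul, integral_const_mul]
      _ ≤ 2 * (ε / 96) + 2 * (ε / 96) := by gcongr
      _ = ε / 24 := by ring
  -- the window in `t`
  set Dh : ℝ := ∫ x, ‖fderiv ℝ h x‖ ^ 2 with hDh
  have hDh0 : 0 ≤ Dh := integral_nonneg fun x => by positivity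
  refine ⟨ε / (8 * (|Cm| + 1) * (Dh + 1)), by positivity, fun t ht hdist => ?_⟩
  have ht0 : 0 < t := ht
  rw [Real.dist_0_eq_abs, abs_of_pos ht0] at hdist
  rw [Real.dist_0_eq_abs, abs_of_nonneg (integral_nonneg fun x => by positivity)]
  -- bookkeeping at time `t`
  have mEG : MemLp (heatExtension G t) 2 volume :=
    memLp_heatExtension_holds (E := EuclideanSpace ℝ (Fin 3)) (F := EuclideanSpace ℝ (Fin 3)) hG one_le_two ht0
  have mEh : MemLp (heatExtension h t) 2 volume :=
    memLp_heatExtension_holds (E := EuclideanSpace ℝ (Fin 3)) (F := EuclideanSpace ℝ (Fin 3)) hhc2 one_le_two ht0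
  have IA : Integrable (fun x => ‖heatExtension G t x - heatExtension h t x‖ ^ 2) := integrable_norm_sq_of_memLp_two (mEG.sub mEh)
  have IB : Integrable (fun x => ‖heatExtension h t x - h x‖ ^ 2) := integrable_norm_sq_of_memLp_two (mEh.sub hhc2)
  have IC : Integrable (fun x => ‖h x - G x‖ ^ 2) := integrable_norm_sq_of_memLp_two (hhc2.sub hG)
  -- (a) contraction on `G − h`
  have hA : ∫ x, ‖heatExtension G t x - heatExtension h t x‖ ^ 2 ≤ ε / 24 := by
    have e : ∀ x, heatExtension G t x - heatExtension h t x = heatExtension (fun y => G y - h y) t x :=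
      fun x => (heatExtension_sub_apply hG hhc2 ht0 x).symm
    calc ∫ x, ‖heatExtension G t x - heatExtension h t x‖ ^ 2 = ∫ x, ‖heatExtension (fun y => G y - h y) t x‖ ^ 2 :=
          integral_congr_ae (ae_of_all _ fun x => by
            show ‖heatExtension G t x - heatExtension h t x‖ ^ 2 = ‖heatExtension (fun y => G y - h y) t x‖ ^ 2
            rw [e x])
      _ ≤ ∫ x, ‖G x - h x‖ ^ 2 := integral_norm_sq_heatExtension_le (hG.sub hhc2) ht0
      _ ≤ ε / 24 := hGh
  -- (b) mollification estimate on `h`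
  have hB : ∫ x, ‖heatExtension h t x - h x‖ ^ 2 ≤ |Cm| * t * Dh := by
    have h' := (hM h hh1 Ih2 IDh t ht0).2
    have e : ∫ x, ‖heatExtension h t x - h x‖ ^ 2 = ∫ x, ‖h x - heatExtension h t x‖ ^ 2 :=
      integral_congr_ae (ae_of_all _ fun x => by
        show ‖heatExtension h t x - h x‖ ^ 2 = ‖h x - heatExtension h t x‖ ^ 2
        rw [norm_sub_rev])
    rw [e]
    refine h'.trans ?_
    gcongr
    exact le_abs_self Cm
  have hB' : |Cm| * t * Dh < ε / 8 := by
    have h1 : |Cm| * t * Dh ≤ (|Cm| + 1) * t * (Dh + 1) := by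
      gcongr <;> linarith [abs_nonneg Cm]
    have h2 : (|Cm| + 1) * t * (Dh + 1) < (|Cm| + 1) * (ε / (8 * (|Cm| + 1) * (Dh + 1))) * (Dh + 1) := by
      gcongr
    have h3 : (|Cm| + 1) * (ε / (8 * (|Cm| + 1) * (Dh + 1))) * (Dh + 1) = ε / 8 := by
      field_simp
    linarith
  -- (c) `∫‖h − G‖² ≤ ε/24`
  have hC : ∫ x, ‖h x - G x‖ ^ 2 ≤ ε / 24 := by
    rw [show (fun x => ‖h x - G x‖ ^ 2) = fun x => ‖G x - h x‖ ^ 2 from funext fun x => by rw [norm_sub_rev]]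
    exact hGh
  -- assemble with the three-term bound
  have IABC : Integrable (fun x => ‖heatExtension G t x - heatExtension h t x‖ ^ 2 + ‖heatExtension h t x - h x‖ ^ 2 +
      ‖h x - G x‖ ^ 2) := (IA.add IB).add IC
  have IAB : Integrable (fun x => ‖heatExtension G t x - heatExtension h t x‖ ^ 2 + ‖heatExtension h t x - h x‖ ^ 2) := IA.add IB
  calc ∫ x, ‖heatExtension G t x - G x‖ ^ 2
      ≤ ∫ x, 3 * (‖heatExtension G t x - heatExtension h t x‖ ^ 2 + ‖heatExtension h t x - h x‖ ^ 2 + ‖h x - G x‖ ^ 2) :=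
        integral_mono_of_nonneg (ae_of_all _ fun x => by positivity) (IABC.const_mul 3)
          (ae_of_all _ fun x => norm_sub_sq_le_three _ _ _ _)
    _ = 3 * ((∫ x, ‖heatExtension G t x - heatExtension h t x‖ ^ 2) + (∫ x, ‖heatExtension h t x - h x‖ ^ 2) +
          ∫ x, ‖h x - G x‖ ^ 2) := by
        rw [integral_const_mul, integral_add IAB IC, integral_add IA IB]
    _ < ε := by linarith [hA, hB, hB', hC]

/-- **`NearSaturationNearMaximiser` (stmt-25482) from the mollification estimate and the regularity of the limit profile, BY NAME.**
Hypothesis (HC) of `nearSaturationNearMaximiser_of_heat_of_identification` discharged by `heat_L2_continuity_of_mollification`.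
Remaining: (HM) `∫‖g − e^{tΔ}g‖² ≤ C_m·t·∫‖Dg‖²` for `C¹` fields with `g, Dg ∈ L²` (standard), and (I) the identification of the
weak-limit gradient / local vorticity limit with an ADMISSIBLE profile (open). [folklore] -/
theorem nearSaturationNearMaximiser_of_mollification_of_identification
    (HM : ∃ Cm : ℝ, ∀ g : EuclideanSpace ℝ (Fin 3) → EuclideanSpace ℝ (Fin 3), ContDiff ℝ 1 g →
      Integrable (fun x => ‖g x‖ ^ 2) → Integrable (fun x => ‖fderiv ℝ g x‖ ^ 2) → ∀ t : ℝ, 0 < t →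
        Integrable (fun x => ‖g x - heatExtension g t x‖ ^ 2) ∧
          ∫ x, ‖g x - heatExtension g t x‖ ^ 2 ≤ Cm * t * ∫ x, ‖fderiv ℝ g x‖ ^ 2)
    (HI : ∀ c : ℝ, (0 < c ∧ (∀ v : EuclideanSpace ℝ (Fin 3) → EuclideanSpace ℝ (Fin 3), (ContDiff ℝ (⊤ : ℕ∞) v ∧
      Literature.Analysis.FluidPDE.VectorCalculus.IsDivFree v ∧ (∫⁻ x, ‖iteratedFDeriv ℝ 0 v x‖ₑ ^ 2 < ⊤) ∧
      (∫⁻ x, ‖iteratedFDeriv ℝ 1 v x‖ₑ ^ 2 < ⊤) ∧ (∫⁻ x, ‖iteratedFDeriv ℝ 2 v x‖ₑ ^ 2 < ⊤)) → (∫ x,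
      ⟪Literature.Analysis.FluidPDE.curl v x, fderiv ℝ v x (Literature.Analysis.FluidPDE.curl v x)⟫_ℝ) ≤ c *
      (∫ x, ‖Literature.Analysis.FluidPDE.curl v x‖ ^ 2) ^ (3 / 4 : ℝ) * (∫ x,
      Literature.Analysis.FluidPDE.frobeniusNormSq (fderiv ℝ (Literature.Analysis.FluidPDE.curl v) x)) ^ (3 / 4 : ℝ)) ∧ ∀ c' : ℝ, (∀ w : EuclideanSpace ℝ (Fin 3) → EuclideanSpace ℝ (Fin 3), (ContDiff ℝ (⊤ : ℕ∞) w ∧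
      Literature.Analysis.FluidPDE.VectorCalculus.IsDivFree w ∧ (∫⁻ x, ‖iteratedFDeriv ℝ 0 w x‖ₑ ^ 2 < ⊤) ∧
      (∫⁻ x, ‖iteratedFDeriv ℝ 1 w x‖ₑ ^ 2 < ⊤) ∧ (∫⁻ x, ‖iteratedFDeriv ℝ 2 w x‖ₑ ^ 2 < ⊤)) → (∫ x,
      ⟪Literature.Analysis.FluidPDE.curl w x, fderiv ℝ w x (Literature.Analysis.FluidPDE.curl w x)⟫_ℝ) ≤ c' *
      (∫ x, ‖Literature.Analysis.FluidPDE.curl w x‖ ^ 2) ^ (3 / 4 : ℝ) * (∫ x,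
      Literature.Analysis.FluidPDE.frobeniusNormSq (fderiv ℝ (Literature.Analysis.FluidPDE.curl w) x)) ^ (3 / 4 : ℝ)) → c ≤ c') →
      ∀ K δ : ℝ, 0 < K → 0 < δ → ∀ v : ℕ → EuclideanSpace ℝ (Fin 3) → EuclideanSpace ℝ (Fin 3),
      (∀ n, (ContDiff ℝ (⊤ : ℕ∞) (v n) ∧
      Literature.Analysis.FluidPDE.VectorCalculus.IsDivFree (v n) ∧ (∫⁻ x, ‖iteratedFDeriv ℝ 0 (v n) x‖ₑ ^ 2 < ⊤) ∧
      (∫⁻ x, ‖iteratedFDeriv ℝ 1 (v n) x‖ₑ ^ 2 < ⊤) ∧ (∫⁻ x, ‖iteratedFDeriv ℝ 2 (v n) x‖ₑ ^ 2 < ⊤))) →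
      (∀ n, (∫ x, ‖Literature.Analysis.FluidPDE.curl (v n) x‖ ^ 2) = 1) →
      (∀ n, (∫ x, Literature.Analysis.FluidPDE.frobeniusNormSq (fderiv ℝ (Literature.Analysis.FluidPDE.curl (v n)) x)) = 1) →
      Tendsto (fun n => ∫ x, ⟪Literature.Analysis.FluidPDE.curl (v n) x, fderiv ℝ (v n) x
        (Literature.Analysis.FluidPDE.curl (v n) x)⟫_ℝ) atTop (𝓝 c) →
      (∀ᶠ n in atTop, δ ≤ ∫ x in Metric.ball (0 : EuclideanSpace ℝ (Fin 3)) K, ‖Literature.Analysis.FluidPDE.curl (v n) x‖ ^ 2) →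
      ∀ (φ₀ : ℕ → ℕ) (M : Fin 3 → EuclideanSpace ℝ (Fin 3) → EuclideanSpace ℝ (Fin 3))
        (Ω : EuclideanSpace ℝ (Fin 3) → EuclideanSpace ℝ (Fin 3)), StrictMono φ₀ →
      (∀ j, MemLp (M j) 2 volume) →
      (∀ (j : Fin 3) (ψ : EuclideanSpace ℝ (Fin 3) → EuclideanSpace ℝ (Fin 3)), MemLp ψ 2 volume →
        Tendsto (fun k => ∫ x, ⟪fderiv ℝ (v (φ₀ k)) x (EuclideanSpace.basisFun (Fin 3) ℝ j), ψ x⟫_ℝ) atTop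
          (𝓝 (∫ x, ⟪M j x, ψ x⟫_ℝ))) →
      MemLp Ω 2 volume →
      (∀ R : ℝ, 0 < R → Tendsto (fun k => ∫ x in Metric.ball (0 : EuclideanSpace ℝ (Fin 3)) R,
          ‖Literature.Analysis.FluidPDE.curl (v (φ₀ k)) x - Ω x‖ ^ 2) atTop (𝓝 0)) →
      ∃ w : EuclideanSpace ℝ (Fin 3) → EuclideanSpace ℝ (Fin 3), (ContDiff ℝ (⊤ : ℕ∞) w ∧
      Literature.Analysis.FluidPDE.VectorCalculus.IsDivFree w ∧ (∫⁻ x, ‖iteratedFDeriv ℝ 0 w x‖ₑ ^ 2 < ⊤) ∧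
      (∫⁻ x, ‖iteratedFDeriv ℝ 1 w x‖ₑ ^ 2 < ⊤) ∧ (∫⁻ x, ‖iteratedFDeriv ℝ 2 w x‖ₑ ^ 2 < ⊤)) ∧
        (∀ j : Fin 3, (fun x => fderiv ℝ w x (EuclideanSpace.basisFun (Fin 3) ℝ j)) =ᵐ[volume] M j) ∧
        Literature.Analysis.FluidPDE.curl w =ᵐ[volume] Ω) :
    Summit.NavierStokesRegularity.NavierStokesRegularity.Theses.EfficiencyFloor.NearSaturationNearMaximiser :=
  nearSaturationNearMaximiser_of_heat_of_identification HM (heat_L2_continuity_of_mollification HM) HI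

end SeqCore

end NearSaturationNearMaximiser

end Summit.NavierStokesRegularity.NavierStokesRegularity.Theorems

end
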